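import Literature.Geometry.GeometricMeasureTheory.RectifiablePieces
import Literature.Geometry.GeometricMeasureTheory.PushforwardMultivector
import Literature.Geometry.GeometricMeasureTheory.MassComplete

/-!
# The push-forward of a rectifiable current along a smooth map is rectifiable (Federer 4.1.30)

Let `T ∈ 𝓡_m(V)` be a rectifiable current with compact support on a finite-dimensional real
inner product space `V`, `f : V → V'` smooth and `χ` a cutoff equal to `1` on `spt T`. Then
**`f_# T ∈ 𝓡_m(V')`** (`Current.IsRectifiable.pushforward_top`).

Proof (Federer 4.1.30 via 4.1.28 and the area formula). Write `T = [W, θ, ξ]` with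
`W ⊆ spt T` of finite `𝓗^m`-measure (`exists_data_subset`), and decompose `W`, up to a null set,
into disjoint bi-Lipschitz pieces `gⱼ(Eⱼ)` on which `ξ` spans `im Dgⱼ`
(`IsRectifiableData.exists_pieces`). On `Eⱼ` the frame `ξ ∘ gⱼ` is `± J(gⱼ)⁻¹ Dgⱼ e`
(`frameVector_eq_sign_smul_of_span_eq_range`), which defines a parameter-side integer density
`pieceDensity = ± θ ∘ gⱼ` with `∫_{gⱼ(Eⱼ)} θ ψ(f y)(Df ξ) d𝓗^m = ∫_{Eⱼ} pieceDensity · ψ(Fⱼ u)(DFⱼ e) du`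
(`Fⱼ = f ∘ gⱼ`; area formula). The set where `DFⱼ` is not injective contributes nothing
(`apply_comp_eq_zero_of_not_injective`); the rest splits into pieces on which `Fⱼ` is
anti-Lipschitz (`exists_antilipschitz_pieces`), whose image currents are rectifiable with explicit
data (`isRectifiableData_image_density`). So `f_# T = Σₖ Rₖ` with `Rₖ ∈ 𝓡_m(V')`, supports in
`f(spt T)`, and `Σₖ 𝐌(Rₖ) ≤ ‖Df‖ᵐ_∞ 𝐌(T) < ∞`; the `𝐌`-limit of the partial sums exists in
`𝓡_m(V')` (`Current.IsRectifiable.exists_limit_of_tsum_mass_ne_top`, Federer 4.1.24) and equals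
`f_# T`.

Definitions with bodies (`pieceDensity`) + theorems; no named facts.

## References

* H. Federer, *Geometric Measure Theory*, Springer 1969, 4.1.30 (with 4.1.24, 4.1.28, 3.2.18–3.2.20)
  [Federer1969].
-/

noncomputable section

open scoped InnerProductSpace ENNReal NNReal Topology Distributions ContDiff
open MeasureTheory MeasureTheory.Measure Set Function Filter Module InnerProductSpace TopologicalSpace
open Literature.Analysis.Calculus

namespace Literature.Geometry.GeometricMeasureTheory

-- Nested operator-norm instances on (duals of) `V [⋀^Fin n]→L[ℝ] ℝ`.
set_option maxSynthPendingDepth 2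

variable {V : Type*} [NormedAddCommGroup V] [InnerProductSpace ℝ V] [FiniteDimensional ℝ V]
  [MeasurableSpace V] [BorelSpace V]
  {V' : Type*} [NormedAddCommGroup V'] [InnerProductSpace ℝ V'] [FiniteDimensional ℝ V']
  [MeasurableSpace V'] [BorelSpace V'] {m : ℕ}

local notation "𝔼" => EuclideanSpace ℝ (Fin m)
local notation "𝕖" => EuclideanSpace.basisFun (Fin m) ℝ

/-! ### The parameter-side density of a piece -/

section Piece

variable {g : EuclideanSpace ℝ (Fin m) → V} {E : Set (EuclideanSpace ℝ (Fin m))}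
  {θ : V → ℤ} {ξ : V → Fin m → V}

/-- **The parameter-side density `± θ ∘ g` of a piece**: the sign compares the orientation of the
frame `ξ(g u)` with that of `Dg(u) e₁ ∧ ⋯ ∧ Dg(u) eₘ` (and the density is `0` where they are not
comparable, a null set). [cite: Federer1969, 4.1.30, 3.2.19] -/
def pieceDensity (g : EuclideanSpace ℝ (Fin m) → V) (θ : V → ℤ) (ξ : V → Fin m → V)
    (u : EuclideanSpace ℝ (Fin m)) : ℤ :=
  open scoped Classical in
  if h : ∃ σ : ℝ, (σ = 1 ∨ σ = -1) ∧ frameVector (ξ (g u)) =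
      (σ * (((fderiv ℝ g u : 𝔼 →L[ℝ] V) : 𝔼 →ₗ[ℝ] V).normDet)⁻¹) •
        frameVector fun j => fderiv ℝ g u (𝕖 j)
  then (if h.choose = 1 then θ (g u) else -θ (g u)) else 0

omit [MeasurableSpace V] [BorelSpace V] [FiniteDimensional ℝ V] in
/-- `|pieceDensity| ≤ |θ ∘ g|`. [folklore] -/
theorem abs_pieceDensity_le (u : EuclideanSpace ℝ (Fin m)) :
    |(pieceDensity g θ ξ u : ℝ)| ≤ |(θ (g u) : ℝ)| := by
  classical
  unfold pieceDensity
  split_ifs <;> simp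

omit [MeasurableSpace V] [BorelSpace V] [FiniteDimensional ℝ V] in
/-- **Key pointwise identity**: where `ξ(g u)` is an orthonormal frame of `im Dg(u)` (`Dg(u)`
injective), `pieceDensity(u) • (Dg e₁ ∧ ⋯ ∧ Dg eₘ) = J(Dg u) • θ(g u) • (ξ₁ ∧ ⋯ ∧ ξₘ)(g u)`.
[cite: Federer1969, 3.2.19, 4.1.30] -/
theorem pieceDensity_smul_frameVector {u : EuclideanSpace ℝ (Fin m)}
    (hinj : Injective (fderiv ℝ g u)) (hortho : Orthonormal ℝ (ξ (g u)))
    (hspan : (Submodule.span ℝ (range (ξ (g u))) : Set V) = range (fderiv ℝ g u)) :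
    (pieceDensity g θ ξ u : ℝ) • frameVector (fun j => fderiv ℝ g u (𝕖 j)) =
      (((fderiv ℝ g u : 𝔼 →L[ℝ] V) : 𝔼 →ₗ[ℝ] V).normDet) •
        ((θ (g u) : ℝ) • frameVector (ξ (g u))) := by
  classical
  set J : ℝ := ((fderiv ℝ g u : 𝔼 →L[ℝ] V) : 𝔼 →ₗ[ℝ] V).normDet with hJ
  have hJ0 : J ≠ 0 := by
    rw [hJ, Ne, LinearMap.normDet_eq_zero_iff_ker_ne_bot, not_not]
    exact LinearMap.ker_eq_bot.2 hinj
  have hex : ∃ σ : ℝ, (σ = 1 ∨ σ = -1) ∧ frameVector (ξ (g u)) =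
      (σ * J⁻¹) • frameVector fun j => fderiv ℝ g u (𝕖 j) :=
    frameVector_eq_sign_smul_of_span_eq_range hinj 𝕖 hortho hspan
  have hσ := hex.choose_spec
  unfold pieceDensity
  rw [dif_pos hex]
  conv_rhs => rw [hσ.2]
  rcases hσ.1 with h1 | h1
  · rw [if_pos h1, h1]
    simp only [smul_smul]
    congr 1
    field_simp
  · have hne : hex.choose ≠ 1 := by rw [h1]; norm_num
    rw [if_neg hne, h1]
    simp only [Int.cast_neg, smul_smul]
    congr 1
    field_simp

variable {f : V → V'}

omit [MeasurableSpace V] [BorelSpace V] [FiniteDimensional ℝ V] [FiniteDimensional ℝ V']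
  [MeasurableSpace V'] [BorelSpace V'] in
/-- The composite differential `DF(u) = Df(g u) ∘ Dg(u)` pushes the piece frame forward:
`pieceDensity • (DF e₁ ∧ ⋯) = J(Dg) • ⋀_m Df (θ • ξ)(g u)`. [cite: Federer1969, 4.1.30] -/
theorem pieceDensity_smul_frameVector_comp {u : EuclideanSpace ℝ (Fin m)}
    (hinj : Injective (fderiv ℝ g u)) (hortho : Orthonormal ℝ (ξ (g u)))
    (hspan : (Submodule.span ℝ (range (ξ (g u))) : Set V) = range (fderiv ℝ g u)) :
    (pieceDensity g θ ξ u : ℝ) •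
        frameVector (fun j => ((fderiv ℝ f (g u)).comp (fderiv ℝ g u)) (𝕖 j)) =
      (((fderiv ℝ g u : 𝔼 →L[ℝ] V) : 𝔼 →ₗ[ℝ] V).normDet) •
        Multivector.push (fderiv ℝ f (g u)) ((θ (g u) : ℝ) • frameVector (ξ (g u))) := by
  have h := congrArg (Multivector.push (m := m) (fderiv ℝ f (g u)))
    (pieceDensity_smul_frameVector (θ := θ) hinj hortho hspan)
  rw [map_smul, map_smul, Multivector.push_frameVector] at h
  exact h

omit [FiniteDimensional ℝ V'] [MeasurableSpace V'] [BorelSpace V'] in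
/-- **The a.e. identity on a piece**: for a.e. `u ∈ E`,
`pieceDensity • (DF e₁ ∧ ⋯ ∧ DF eₘ) = J(Dg u) • ⋀_m Df(g u) (θ • ξ)(g u)`.
[cite: Federer1969, 4.1.30] -/
theorem ae_pieceDensity_smul_frameVector_comp (hE : MeasurableSet E)
    (hgd : ∀ u ∈ E, DifferentiableAt ℝ g u ∧ Injective (fderiv ℝ g u)) (hgi : InjOn g E)
    (hframe : ∀ᵐ y ∂((μHE[m] : Measure V).restrict (g '' E)), ∀ u ∈ E, g u = y →
      Orthonormal ℝ (ξ y) ∧ ((Submodule.span ℝ (range (ξ y)) : Set V) = range (fderiv ℝ g u))) :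
    ∀ᵐ u ∂(volume.restrict E),
      (pieceDensity g θ ξ u : ℝ) •
          frameVector (fun j => ((fderiv ℝ f (g u)).comp (fderiv ℝ g u)) (𝕖 j)) =
        (((fderiv ℝ g u : 𝔼 →L[ℝ] V) : 𝔼 →ₗ[ℝ] V).normDet) •
          Multivector.push (fderiv ℝ f (g u)) ((θ (g u) : ℝ) • frameVector (ξ (g u))) := by
  have hgd' : ∀ u ∈ E, HasFDerivWithinAt g (fderiv ℝ g u) E u := fun u hu =>
    (hgd u hu).1.hasFDerivAt.hasFDerivWithinAt
  have hframe' : ∀ᵐ y ∂((μHE[finrank ℝ 𝔼] : Measure V).restrict (g '' E)), ∀ u ∈ E, g u = y →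
      Orthonormal ℝ (ξ y) ∧ ((Submodule.span ℝ (range (ξ y)) : Set V) = range (fderiv ℝ g u)) := by
    rwa [finrank_euclideanSpace_fin]
  have h := ae_restrict_comp_of_ae_restrict_image hE hgd' (fun u hu => (hgd u hu).2) hgi hframe'
  rw [ae_restrict_iff' hE] at h ⊢
  filter_upwards [h] with u hu huE
  obtain ⟨ho, hs⟩ := hu huE u huE rfl
  exact pieceDensity_smul_frameVector_comp (hgd u huE).2 ho hs

/-! #### Integrability, the integral identity and the mass bound on a piece -/

variable {f : V → V'}

omit [MeasurableSpace V'] [BorelSpace V'] in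
/-- The pushed density field `y ↦ ⋀_m Df(y) (θ • ξ)(y)` is integrable on the piece when
`θ • ξ` is and `Df` is bounded there. [folklore] -/
theorem integrableOn_push_smul_frameVector (hf : ContDiff ℝ 1 f) {C : ℝ} {S : Set V}
    (hC : ∀ y ∈ S, ‖fderiv ℝ f y‖ ≤ C) (hSm : MeasurableSet S)
    (hG : IntegrableOn (fun y => (θ y : ℝ) • frameVector (ξ y)) S (μHE[m] : Measure V)) :
    IntegrableOn (fun y => Multivector.push (m := m) (fderiv ℝ f y) ((θ y : ℝ) • frameVector (ξ y)))
      S (μHE[m] : Measure V) := by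
  have hmeas : AEStronglyMeasurable
      (fun y => Multivector.push (m := m) (fderiv ℝ f y) ((θ y : ℝ) • frameVector (ξ y)))
      ((μHE[m] : Measure V).restrict S) := by
    refine Continuous.comp_aestronglyMeasurable₂ (g := fun (A : V →L[ℝ] V') (w : Multivector V m) =>
      Multivector.push A w) ?_ ?_ hG.aestronglyMeasurable
    · exact Multivector.continuous_push_uncurry
    · exact ((hf.continuous_fderiv one_ne_zero).aestronglyMeasurable)
  refine Integrable.mono' (hG.norm.const_mul (C ^ m)) hmeas ?_
  rw [ae_restrict_iff' hSm]
  refine Eventually.of_forall fun y hy => ?_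
  calc ‖Multivector.push (m := m) (fderiv ℝ f y) ((θ y : ℝ) • frameVector (ξ y))‖
      ≤ ‖fderiv ℝ f y‖ ^ m * ‖(θ y : ℝ) • frameVector (ξ y)‖ := Multivector.norm_push_le _ _
    _ ≤ C ^ m * ‖(θ y : ℝ) • frameVector (ξ y)‖ := by
        gcongr
        exact hC y hy

omit [MeasurableSpace V'] [BorelSpace V'] in
/-- **Integrability of the parameter-side density of a piece**:
`u ↦ pieceDensity(u) • (DF e₁ ∧ ⋯ ∧ DF eₘ)` is integrable on `E`. [cite: Federer1969, 4.1.30] -/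
theorem integrableOn_pieceDensity_smul_frameVector_comp (hE : MeasurableSet E)
    (hgd : ∀ u ∈ E, DifferentiableAt ℝ g u ∧ Injective (fderiv ℝ g u)) (hgi : InjOn g E)
    (hframe : ∀ᵐ y ∂((μHE[m] : Measure V).restrict (g '' E)), ∀ u ∈ E, g u = y →
      Orthonormal ℝ (ξ y) ∧ ((Submodule.span ℝ (range (ξ y)) : Set V) = range (fderiv ℝ g u)))
    (hf : ContDiff ℝ 1 f) {C : ℝ} (hC : ∀ y ∈ g '' E, ‖fderiv ℝ f y‖ ≤ C)
    (hG : IntegrableOn (fun y => (θ y : ℝ) • frameVector (ξ y)) (g '' E) (μHE[m] : Measure V)) :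
    IntegrableOn (fun u => (pieceDensity g θ ξ u : ℝ) •
      frameVector (fun j => ((fderiv ℝ f (g u)).comp (fderiv ℝ g u)) (𝕖 j))) E := by
  have hgd' : ∀ u ∈ E, HasFDerivWithinAt g (fderiv ℝ g u) E u := fun u hu =>
    (hgd u hu).1.hasFDerivAt.hasFDerivWithinAt
  have hinj' : ∀ u ∈ E, Injective (fderiv ℝ g u) := fun u hu => (hgd u hu).2
  have hgEm : MeasurableSet (g '' E) := measurableSet_image_of_hasFDerivWithinAt hE hgd' hgi
  have hH := integrableOn_push_smul_frameVector (θ := θ) (ξ := ξ) hf hC hgEm hG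
  have hH' : IntegrableOn
      (fun y => Multivector.push (m := m) (fderiv ℝ f y) ((θ y : ℝ) • frameVector (ξ y)))
      (g '' E) (μHE[finrank ℝ 𝔼] : Measure V) := by
    rwa [finrank_euclideanSpace_fin]
  have h1 := (integrableOn_image_iff_integrableOn_normDet_smul hE hgd' hinj' hgi _).1 hH'
  refine h1.congr_fun_ae ?_
  filter_upwards [ae_pieceDensity_smul_frameVector_comp (θ := θ) (f := f) hE hgd hgi hframe]
    with u hu
  exact hu.symm

omit [FiniteDimensional ℝ V] [MeasurableSpace V] [BorelSpace V] [FiniteDimensional ℝ V']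
  [MeasurableSpace V'] [BorelSpace V'] in
/-- Pointwise: `θ · ψ(f y)(Df ξ₁, …, Df ξₘ) = (⋀_m Df (θ • ξ))(ψ(f y))`. [folklore] -/
theorem mul_apply_comp_frame_eq_push (ψ : V' → Covector V' m) (y : V) :
    (θ y : ℝ) * ψ (f y) (fun i => fderiv ℝ f y (ξ y i)) =
      Multivector.push (fderiv ℝ f y) ((θ y : ℝ) • frameVector (ξ y)) (ψ (f y)) := by
  rw [Multivector.push_apply, _root_.smul_apply, frameVector_apply, smul_eq_mul,
    ContinuousAlternatingMap.compContinuousLinearMap_apply]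
  rfl

omit [FiniteDimensional ℝ V'] [MeasurableSpace V'] [BorelSpace V'] in
/-- **The integral identity on a piece**:
`∫_{g(E)} θ ψ(f y)(Df ξ) d𝓗^m = ∫_E pieceDensity · ψ(F u)(DF e) du`, `F = f ∘ g`.
[cite: Federer1969, 4.1.30, 3.2.5] -/
theorem setIntegral_image_piece_eq (hE : MeasurableSet E)
    (hgd : ∀ u ∈ E, DifferentiableAt ℝ g u ∧ Injective (fderiv ℝ g u)) (hgi : InjOn g E)
    (hframe : ∀ᵐ y ∂((μHE[m] : Measure V).restrict (g '' E)), ∀ u ∈ E, g u = y →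
      Orthonormal ℝ (ξ y) ∧ ((Submodule.span ℝ (range (ξ y)) : Set V) = range (fderiv ℝ g u)))
    (ψ : V' → Covector V' m) :
    ∫ y in g '' E, (θ y : ℝ) * ψ (f y) (fun i => fderiv ℝ f y (ξ y i)) ∂(μHE[m] : Measure V) =
      ∫ u in E, (pieceDensity g θ ξ u : ℝ) *
        ψ (f (g u)) (fun j => ((fderiv ℝ f (g u)).comp (fderiv ℝ g u)) (𝕖 j)) := by
  have hgd' : ∀ u ∈ E, HasFDerivWithinAt g (fderiv ℝ g u) E u := fun u hu =>
    (hgd u hu).1.hasFDerivAt.hasFDerivWithinAt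
  have hinj' : ∀ u ∈ E, Injective (fderiv ℝ g u) := fun u hu => (hgd u hu).2
  simp_rw [mul_apply_comp_frame_eq_push (θ := θ) (ξ := ξ) (f := f) ψ]
  have h := integral_image_eq_integral_normDet_smul hE hgd' hinj' hgi
    (fun y => Multivector.push (fderiv ℝ f y) ((θ y : ℝ) • frameVector (ξ y)) (ψ (f y)))
  rw [finrank_euclideanSpace_fin] at h
  rw [h]
  refine setIntegral_congr_ae hE ?_
  filter_upwards [(ae_restrict_iff' hE).1
    (ae_pieceDensity_smul_frameVector_comp (θ := θ) (f := f) hE hgd hgi hframe)] with u hu huE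
  have := congrArg (fun w : Multivector V' m => w (ψ (f (g u)))) (hu huE)
  simp only [_root_.smul_apply, frameVector_apply, smul_eq_mul] at this
  rw [this, smul_eq_mul]

omit [FiniteDimensional ℝ V'] [MeasurableSpace V'] [BorelSpace V'] in
/-- **The mass bound on a piece**:
`∫_E ‖pieceDensity • (DF e)‖ du ≤ Cᵐ ∫_{g(E)} ‖θ • ξ‖ d𝓗^m` when `‖Df‖ ≤ C` on `g(E)`.
[cite: Federer1969, 4.1.30] -/
theorem lintegral_piece_le (hE : MeasurableSet E)
    (hgd : ∀ u ∈ E, DifferentiableAt ℝ g u ∧ Injective (fderiv ℝ g u)) (hgi : InjOn g E)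
    (hframe : ∀ᵐ y ∂((μHE[m] : Measure V).restrict (g '' E)), ∀ u ∈ E, g u = y →
      Orthonormal ℝ (ξ y) ∧ ((Submodule.span ℝ (range (ξ y)) : Set V) = range (fderiv ℝ g u)))
    {C : ℝ} (hC0 : 0 ≤ C) (hC : ∀ y ∈ g '' E, ‖fderiv ℝ f y‖ ≤ C) :
    ∫⁻ u in E, ‖(pieceDensity g θ ξ u : ℝ) •
        frameVector (fun j => ((fderiv ℝ f (g u)).comp (fderiv ℝ g u)) (𝕖 j))‖ₑ ≤
      ENNReal.ofReal (C ^ m) *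
        ∫⁻ y in g '' E, ‖(θ y : ℝ) • frameVector (ξ y)‖ₑ ∂(μHE[m] : Measure V) := by
  have hgd' : ∀ u ∈ E, HasFDerivWithinAt g (fderiv ℝ g u) E u := fun u hu =>
    (hgd u hu).1.hasFDerivAt.hasFDerivWithinAt
  have hinj' : ∀ u ∈ E, Injective (fderiv ℝ g u) := fun u hu => (hgd u hu).2
  have h := lintegral_image_eq_lintegral_normDet_mul hE hgd' hinj' hgi
    (fun y => ‖(θ y : ℝ) • frameVector (ξ y)‖ₑ)
  rw [finrank_euclideanSpace_fin] at h
  rw [h, ← lintegral_const_mul' _ _ ENNReal.ofReal_ne_top]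
  refine lintegral_mono_ae ?_
  filter_upwards [ae_pieceDensity_smul_frameVector_comp (θ := θ) (f := f) hE hgd hgi hframe,
    ae_restrict_mem hE] with u hu huE
  rw [hu, enorm_smul, Real.enorm_eq_ofReal (LinearMap.normDet_nonneg _), mul_left_comm]
  gcongr
  rw [← ofReal_norm, ← ofReal_norm, ← ENNReal.ofReal_mul (by positivity)]
  refine ENNReal.ofReal_le_ofReal ?_
  calc ‖Multivector.push (m := m) (fderiv ℝ f (g u)) ((θ (g u) : ℝ) • frameVector (ξ (g u)))‖
      ≤ ‖fderiv ℝ f (g u)‖ ^ m * ‖(θ (g u) : ℝ) • frameVector (ξ (g u))‖ :=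
        Multivector.norm_push_le _ _
    _ ≤ C ^ m * ‖(θ (g u) : ℝ) • frameVector (ξ (g u))‖ := by
        gcongr
        exact hC _ ⟨u, huE, rfl⟩

/-! #### The image current of a sub-piece on which `F = f ∘ g` is bi-Lipschitz -/

omit [FiniteDimensional ℝ V] [MeasurableSpace V] [BorelSpace V] in
/-- **Sub-piece image currents**: on a measurable `E' ⊆ E` where `F = f ∘ g` has injective
differential `DF = Df ∘ Dg` and is Lipschitz and anti-Lipschitz, the current
`R = [F(E'), pieceDensity ∘ F⁻¹, GS(DF e)]` has admissible rectifiable data, is computed by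
`R(ψ) = ∫_{E'} pieceDensity · ψ(F u)(DF e) du`, and has mass `≤ ∫_{E'} ‖pieceDensity • DF e‖`.
[cite: Federer1969, 4.1.28, 4.1.30] -/
theorem subpiece_current
    (hgd : ∀ u ∈ E, DifferentiableAt ℝ g u ∧ Injective (fderiv ℝ g u))
    (hf : ContDiff ℝ 1 f) {E' : Set (EuclideanSpace ℝ (Fin m))} (hE'm : MeasurableSet E')
    (hE'E : E' ⊆ E) (hFinj : ∀ u ∈ E', Injective ((fderiv ℝ f (g u)).comp (fderiv ℝ g u)))
    {K' : ℝ≥0} (hFanti : AntilipschitzWith K' (E'.restrict (f ∘ g))) {L' : ℝ≥0}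
    (hFlip : LipschitzOnWith L' (f ∘ g) E')
    (hint : IntegrableOn (fun u => (pieceDensity g θ ξ u : ℝ) •
      frameVector (fun j => ((fderiv ℝ f (g u)).comp (fderiv ℝ g u)) (𝕖 j))) E') :
    IsRectifiableData (⊤ : Opens V') m ((f ∘ g) '' E')
        (imageDensity (f ∘ g) E' (pieceDensity g θ ξ))
        (imageFrame (f ∘ g) (fun u => (fderiv ℝ f (g u)).comp (fderiv ℝ g u)) E' 𝕖) ∧
      (∀ ψ : TestForm (⊤ : Opens V') m,
        (currentOfIntegration ((f ∘ g) '' E') (imageDensity (f ∘ g) E' (pieceDensity g θ ξ))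
          (imageFrame (f ∘ g) (fun u => (fderiv ℝ f (g u)).comp (fderiv ℝ g u)) E' 𝕖) :
            Current (⊤ : Opens V') m) ψ =
          ∫ u in E', (pieceDensity g θ ξ u : ℝ) *
            ψ (f (g u)) (fun j => ((fderiv ℝ f (g u)).comp (fderiv ℝ g u)) (𝕖 j))) ∧
      (currentOfIntegration ((f ∘ g) '' E') (imageDensity (f ∘ g) E' (pieceDensity g θ ξ))
          (imageFrame (f ∘ g) (fun u => (fderiv ℝ f (g u)).comp (fderiv ℝ g u)) E' 𝕖) :
            Current (⊤ : Opens V') m).mass ≤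
        ∫⁻ u in E', ‖(pieceDensity g θ ξ u : ℝ) •
          frameVector (fun j => ((fderiv ℝ f (g u)).comp (fderiv ℝ g u)) (𝕖 j))‖ₑ := by
  set F : EuclideanSpace ℝ (Fin m) → V' := f ∘ g with hF
  set DF : EuclideanSpace ℝ (Fin m) → EuclideanSpace ℝ (Fin m) →L[ℝ] V' :=
    fun u => (fderiv ℝ f (g u)).comp (fderiv ℝ g u) with hDF
  have hFd : ∀ u ∈ E', HasFDerivWithinAt F (DF u) E' u := fun u hu =>
    (((hf.differentiable one_ne_zero) (g u)).hasFDerivAt.comp u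
      (hgd u (hE'E hu)).1.hasFDerivAt).hasFDerivWithinAt
  have hFi : InjOn F E' := fun a ha b hb h => by
    have := hFanti.injective (a₁ := ⟨a, ha⟩) (a₂ := ⟨b, hb⟩) (by simpa using h)
    exact congrArg Subtype.val this
  refine ⟨isRectifiableData_image_density hE'm hFd hFinj hFanti hFlip hint (subset_univ _),
    fun ψ => currentOfIntegration_image_density_apply hE'm hFd hFinj hFi 𝕖 hint ψ, ?_⟩
  -- the mass bound, by the change of variables for `F`
  refine (mass_vectorCurrent_le _ _).trans (le_of_eq ?_)
  have h := lintegral_image_eq_lintegral_normDet_mul hE'm hFd hFinj hFi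
    (fun z => ‖(imageDensity F E' (pieceDensity g θ ξ) z : ℝ) •
      frameVector (imageFrame F DF E' 𝕖 z)‖ₑ)
  rw [finrank_euclideanSpace_fin] at h
  rw [h]
  refine setLIntegral_congr_fun hE'm fun u hu => ?_
  rw [← Real.enorm_eq_ofReal (LinearMap.normDet_nonneg _), ← enorm_smul,
    normDet_smul_imageDensity_smul_frameVector hFinj hFi 𝕖 _ hu]

end Piece

/-! ### Auxiliary facts -/

section Aux

omit [InnerProductSpace ℝ V] [FiniteDimensional ℝ V] [MeasurableSpace V] [BorelSpace V]
  [FiniteDimensional ℝ V'] [MeasurableSpace V'] [BorelSpace V'] in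
/-- An anti-Lipschitz restriction is injective on the set. [folklore] -/
theorem injOn_of_antilipschitz_restrict [NormedSpace ℝ V] {X : Type*} [EMetricSpace X]
    {g : X → V} {s : Set X} {K : ℝ≥0} (h : AntilipschitzWith K (s.restrict g)) : InjOn g s :=
  fun a ha b hb hab => by
    have := h.injective (a₁ := ⟨a, ha⟩) (a₂ := ⟨b, hb⟩) (by simpa using hab)
    exact congrArg Subtype.val this

omit [InnerProductSpace ℝ V'] [FiniteDimensional ℝ V'] [MeasurableSpace V'] [BorelSpace V'] in
/-- Supports of finite sums of currents. [folklore] -/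
theorem Current.support_finset_sum_subset [NormedSpace ℝ V'] {Ω' : Opens V'} {k : ℕ}
    (R : ℕ → Current Ω' k) {K : Set V'} (hR : ∀ i, (R i).support ⊆ K) (N : ℕ) :
    (∑ i ∈ Finset.range N, R i).support ⊆ K := by
  induction N with
  | zero => simp
  | succ N ih =>
    rw [Finset.sum_range_succ]
    exact (Current.support_add_subset _ _).trans (union_subset ih (hR N))

/-- Finite sums of rectifiable currents on `⊤` are rectifiable. [cite: Federer1969, 4.1.28] -/
theorem Current.IsRectifiable.finset_sum_top {k : ℕ} (R : ℕ → Current (⊤ : Opens V') k)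
    (hR : ∀ i, (R i).IsRectifiable) (N : ℕ) : (∑ i ∈ Finset.range N, R i).IsRectifiable := by
  induction N with
  | zero => simpa using Current.isRectifiable_zero
  | succ N ih =>
    rw [Finset.sum_range_succ]
    exact ih.add_top (hR N)

end Aux

/-! ### The theorem -/

section Main

/-- **Push-forwards of rectifiable currents are rectifiable** (Federer 4.1.30): if
`T ∈ 𝓡_m(V)` (compact support), `f : V → V'` is smooth and the cutoff `χ` equals `1` on `spt T`,
then `f_# T ∈ 𝓡_m(V')`. See the module docstring for the proof. [cite: Federer1969, 4.1.30] -/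
theorem Current.IsRectifiable.pushforward_top {T : Current (⊤ : Opens V) m} (hT : T.IsRectifiable)
    (χ : 𝓓((⊤ : Opens V), ℝ)) (hχ : ∀ x ∈ T.support, χ x = 1) {f : V → V'} (hf : ContDiff ℝ ∞ f) :
    (T.pushforward (⊤ : Opens V') χ hf).IsRectifiable := by
  classical
  have hf1 : ContDiff ℝ 1 f := hf.of_le (by simp)
  have hfd : Differentiable ℝ f := hf.differentiable (by simp)
  /- Step 0: data carried by `K = spt T`, of finite measure. -/
  have hK : IsCompact T.support := hT.2
  obtain ⟨W, θ, ξ, hd, hTeq, hWK, hWfin, -⟩ := hT.exists_data_subset hK Subset.rfl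
  have hWm : MeasurableSet W := hd.1
  set μ : Measure V := (μHE[m] : Measure V) with hμ
  set G : V → Multivector V m := fun y => (θ y : ℝ) • frameVector (ξ y) with hGdef
  have hGint : IntegrableOn G W μ := by
    have h1 : IntegrableOn G T.support (μ.restrict W) :=
      hd.2.2.2.1.integrableOn_compact_subset (subset_univ _) hK
    have : (μ.restrict W).restrict T.support = μ.restrict W := by
      rw [Measure.restrict_restrict hK.isClosed.measurableSet, inter_eq_right.2 hWK]
    rw [IntegrableOn, this] at h1
    exact h1
  -- bounds for `Df`: on `K`, and on a ball around `K` (where `f` is then Lipschitz)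
  obtain ⟨C', hC'⟩ := hK.exists_bound_of_continuousOn
    ((hf.continuous_fderiv (by simp)).continuousOn)
  set C : ℝ := max C' 0 with hCdef
  have hC0 : 0 ≤ C := le_max_right _ _
  have hC : ∀ y ∈ W, ‖fderiv ℝ f y‖ ≤ C := fun y hy => (hC' y (hWK hy)).trans (le_max_left _ _)
  obtain ⟨ρ, hρ⟩ := hK.isBounded.subset_closedBall 0
  obtain ⟨C₁, hC₁⟩ := (isCompact_closedBall (0 : V) ρ).exists_bound_of_continuousOn
    ((hf.continuous_fderiv (by simp)).continuousOn)
  have hflip : LipschitzOnWith (Real.toNNReal C₁) f (Metric.closedBall (0 : V) ρ) :=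
    (convex_closedBall (0 : V) ρ).lipschitzOnWith_of_nnnorm_fderiv_le (𝕜 := ℝ)
      (fun x _ => hfd x) fun x hx => by
        rw [← NNReal.coe_le_coe, coe_nnnorm]
        exact (hC₁ x hx).trans (Real.le_coe_toNNReal C₁)
  /- Step 1: bi-Lipschitz pieces of the data. -/
  obtain ⟨E, g, L, Kg, hEm, hgL, hgK, hgd, hgW, hgm, hdisj, hnull, hframe⟩ := hd.exists_pieces
  have hgi : ∀ j, InjOn (g j) (E j) := fun j => injOn_of_antilipschitz_restrict (hgK j)
  have hint : ∀ j, IntegrableOn (fun u => (pieceDensity (g j) θ ξ u : ℝ) •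
      frameVector (fun i => ((fderiv ℝ f (g j u)).comp (fderiv ℝ (g j) u)) (𝕖 i))) (E j) :=
    fun j => integrableOn_pieceDensity_smul_frameVector_comp (hEm j) (hgd j) (hgi j) (hframe j)
      hf1 (fun y hy => hC y (hgW j hy)) (hGint.mono_set (hgW j))
  /- Step 2: sub-pieces on which `F j = f ∘ g j` is anti-Lipschitz. -/
  have hsub := fun j => exists_antilipschitz_pieces (g := f ∘ g j)
  choose t Kt htm htdisj htS hSt htK using hsub
  have hFd : ∀ j, ∀ u ∈ E j, DifferentiableAt ℝ (f ∘ g j) u ∧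
      fderiv ℝ (f ∘ g j) u = (fderiv ℝ f (g j u)).comp (fderiv ℝ (g j) u) := fun j u hu =>
    ⟨(hfd _).comp u (hgd j u hu).1, fderiv_comp u (hfd _) (hgd j u hu).1⟩
  -- indexing of the sub-pieces `(j, n)` by `k : ℕ`
  let jj : ℕ → ℕ := fun k => k.unpair.1
  let nn : ℕ → ℕ := fun k => k.unpair.2
  let E' : ℕ → Set 𝔼 := fun k => E (jj k) ∩ t (jj k) (nn k)
  have hE'm : ∀ k, MeasurableSet (E' k) := fun k => (hEm _).inter (htm _ _)
  have hFinj : ∀ k, ∀ u ∈ E' k,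
      Injective ((fderiv ℝ f (g (jj k) u)).comp (fderiv ℝ (g (jj k)) u)) := fun k u hu => by
    rw [← (hFd _ u hu.1).2]
    exact (htS _ _ hu.2).2
  have hFanti : ∀ k, AntilipschitzWith (Kt (jj k) (nn k)) ((E' k).restrict (f ∘ g (jj k))) :=
    fun k => (htK _ _).restrict_mono inter_subset_right
  have hgball : ∀ j, MapsTo (g j) (E j) (Metric.closedBall (0 : V) ρ) := fun j u hu =>
    hρ (hWK (hgW j ⟨u, hu, rfl⟩))
  have hFlip : ∀ k, LipschitzOnWith (Real.toNNReal C₁ * L (jj k)) (f ∘ g (jj k)) (E' k) :=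
    fun k => (hflip.comp ((hgL _).lipschitzOnWith) (hgball _)).mono inter_subset_left
  -- the sub-piece currents and their properties
  have hR := fun k => subpiece_current (θ := θ) (ξ := ξ) (hgd (jj k)) hf1 (hE'm k)
    inter_subset_left (hFinj k) (hFanti k) (hFlip k) ((hint _).mono_set inter_subset_left)
  set R : ℕ → Current (⊤ : Opens V') m := fun k =>
    currentOfIntegration ((f ∘ g (jj k)) '' E' k)
      (imageDensity (f ∘ g (jj k)) (E' k) (pieceDensity (g (jj k)) θ ξ))
      (imageFrame (f ∘ g (jj k)) (fun u => (fderiv ℝ f (g (jj k) u)).comp (fderiv ℝ (g (jj k)) u))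
        (E' k) 𝕖) with hRdef
  have hfK : IsCompact (f '' T.support) := hK.image hf.continuous
  have hRK : ∀ k, (R k).support ⊆ f '' T.support := fun k => by
    refine (support_currentOfIntegration_subset_closure _ _ _).trans
      (closure_minimal ?_ hfK.isClosed)
    rintro _ ⟨u, hu, rfl⟩
    exact ⟨g (jj k) u, hWK (hgW _ ⟨u, hu.1, rfl⟩), rfl⟩
  have hRrect : ∀ k, (R k).IsRectifiable := fun k =>
    ⟨⟨_, _, _, (hR k).1, rfl⟩, Current.isCompact_support_of_subset _ hfK (subset_univ _) (hRK k)⟩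
  /- Step 3: the masses are summable. -/
  let a : ℕ → ℝ≥0∞ := fun k => ∫⁻ u in E' k, ‖(pieceDensity (g (jj k)) θ ξ u : ℝ) •
    frameVector (fun i => ((fderiv ℝ f (g (jj k) u)).comp (fderiv ℝ (g (jj k)) u)) (𝕖 i))‖ₑ
  have hmass : ∀ k, (R k).mass ≤ a k := fun k => (hR k).2.2
  -- `Σₙ a (j, n) ≤ Cᵐ ∫_{g j (E j)} ‖G‖`
  let b : ℕ → ℕ → ℝ≥0∞ := fun j n => ∫⁻ u in E j ∩ t j n, ‖(pieceDensity (g j) θ ξ u : ℝ) •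
    frameVector (fun i => ((fderiv ℝ f (g j u)).comp (fderiv ℝ (g j) u)) (𝕖 i))‖ₑ
  have hab : ∀ p : ℕ × ℕ, a (Nat.pairEquiv p) = b p.1 p.2 := by
    rintro ⟨j, n⟩
    simp only [a, b, E', jj, nn, Nat.pairEquiv_apply, Function.uncurry_apply_pair, Nat.unpair_pair]
  have hbj : ∀ j, ∑' n, b j n ≤ ENNReal.ofReal (C ^ m) * ∫⁻ y in g j '' E j, ‖G y‖ₑ ∂μ := by
    intro j
    have h1 : ∑' n, b j n = ∫⁻ u in ⋃ n, E j ∩ t j n, ‖(pieceDensity (g j) θ ξ u : ℝ) •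
        frameVector (fun i => ((fderiv ℝ f (g j u)).comp (fderiv ℝ (g j) u)) (𝕖 i))‖ₑ := by
      rw [lintegral_iUnion (fun n => (hEm j).inter (htm j n))
        (fun n n' h => (htdisj j h).mono inter_subset_right inter_subset_right)]
    rw [h1]
    refine (lintegral_mono_set (iUnion_subset fun n => inter_subset_left)).trans ?_
    exact lintegral_piece_le (hEm j) (hgd j) (hgi j) (hframe j) hC0 (fun y hy => hC y (hgW j hy))
  have hsumG : ∑' j, ∫⁻ y in g j '' E j, ‖G y‖ₑ ∂μ ≤ ∫⁻ y in W, ‖G y‖ₑ ∂μ := by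
    rw [← lintegral_iUnion hgm hdisj]
    exact lintegral_mono_set (iUnion_subset hgW)
  have hGfin : ∫⁻ y in W, ‖G y‖ₑ ∂μ < ⊤ := hGint.2
  have hsum : ∑' k, a k ≠ ⊤ := by
    have h1 : ∑' k, a k = ∑' p : ℕ × ℕ, b p.1 p.2 := by
      rw [← Nat.pairEquiv.tsum_eq]
      exact tsum_congr hab
    rw [h1, ENNReal.tsum_prod]
    refine ne_top_of_le_ne_top ?_ (ENNReal.tsum_le_tsum hbj)
    rw [ENNReal.tsum_mul_left]
    exact ENNReal.mul_ne_top ENNReal.ofReal_ne_top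
      (ne_top_of_le_ne_top hGfin.ne hsumG)
  have hsum' : ∑' k, (R k).mass ≠ ⊤ := ne_top_of_le_ne_top hsum (ENNReal.tsum_le_tsum hmass)
  /- Step 4: the `𝐌`-limit of the partial sums. -/
  set S : ℕ → Current (⊤ : Opens V') m := fun N => ∑ k ∈ Finset.range N, R k with hSdef
  have hSrect : ∀ N, (S N).IsRectifiable := fun N => Current.IsRectifiable.finset_sum_top R hRrect N
  have hSK : ∀ N, (S N).support ⊆ f '' T.support := fun N =>
    Current.support_finset_sum_subset R hRK N
  have hSdiff : ∀ N, S (N + 1) - S N = R N := fun N => by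
    simp only [hSdef, Finset.sum_range_succ, add_sub_cancel_left]
  obtain ⟨T', hT'rect, -, hT'lim⟩ := Current.IsRectifiable.exists_limit_of_tsum_mass_ne_top
    hfK S hSrect hSK (by simpa only [hSdiff] using hsum')
  /- Step 5: identification `f_# T = T'`. -/
  suffices heq : T.pushforward (⊤ : Opens V') χ hf = T' by rw [heq]; exact hT'rect
  ext ψ
  -- a bound for `ψ`
  obtain ⟨c₀, hc₀⟩ := ψ.hasCompactSupport.exists_bound_of_continuous ψ.continuous
  set c : ℝ := max c₀ 0 + 1 with hcdef
  have hc : 0 < c := by positivity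
  have hψc : ∀ z, ‖ψ z‖ ≤ c := fun z => (hc₀ z).trans (by
    rw [hcdef]; linarith [le_max_left c₀ 0])
  -- (a) `S N ψ → T' ψ`
  have hlim1 : Tendsto (fun N => S N ψ) atTop (𝓝 (T' ψ)) := by
    have hfin : ∀ᶠ N in atTop, (S N - T').mass < 1 := hT'lim.eventually (gt_mem_nhds one_pos)
    have htoReal : Tendsto (fun N => ((S N - T').mass).toReal) atTop (𝓝 0) := by
      have := (ENNReal.tendsto_toReal ENNReal.zero_ne_top).comp hT'lim
      simpa only [Function.comp_def, ENNReal.toReal_zero] using this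
    rw [tendsto_iff_norm_sub_tendsto_zero]
    refine squeeze_zero' (Eventually.of_forall fun N => norm_nonneg _) ?_
      (by simpa using htoReal.const_mul c)
    filter_upwards [hfin] with N hN
    rw [Real.norm_eq_abs, ← _root_.sub_apply]
    exact Current.abs_apply_le_mul_toReal_mass _ hN.ne_top hc hψc
  -- (b) `S N ψ → Σₖ R k ψ`
  have hRψ : Summable fun k => R k ψ := by
    have ha : ∀ k, a k ≠ ⊤ := fun k => ne_top_of_le_ne_top hsum (ENNReal.le_tsum k)
    refine Summable.of_norm_bounded (g := fun k => c * (a k).toReal)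
      ((ENNReal.summable_toReal hsum).mul_left c) fun k => ?_
    rw [Real.norm_eq_abs]
    refine (Current.abs_apply_le_mul_toReal_mass _ (ne_top_of_le_ne_top (ha k) (hmass k)) hc
      hψc).trans ?_
    gcongr
    · exact ha k
    · exact hmass k
  have hlim2 : Tendsto (fun N => S N ψ) atTop (𝓝 (∑' k, R k ψ)) := by
    have : (fun N => S N ψ) = fun N => ∑ k ∈ Finset.range N, R k ψ := by
      funext N
      simp only [hSdef, FunLike.coe_sum, Finset.sum_apply]
    rw [this]
    exact hRψ.hasSum.tendsto_sum_nat
  have hT'ψ : T' ψ = ∑' k, R k ψ := tendsto_nhds_unique hlim1 hlim2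
  rw [hT'ψ]
  /- (c) `f_# T ψ = Σₖ R k ψ`: the push-forward integral decomposes over the pieces. -/
  -- the integrand of `f_# T ψ`
  set Φ : V → ℝ := fun x => (θ x : ℝ) * ψ (f x) (fun i => fderiv ℝ f x (ξ x i)) with hΦdef
  have hpush : T.pushforward (⊤ : Opens V') χ hf ψ = ∫ x in W, Φ x ∂μ := by
    rw [Current.pushforward_apply, hTeq, currentOfIntegration_apply hd.2.2.2.1]
    refine setIntegral_congr_fun hWm fun x hx => ?_
    simp only [hΦdef, TestForm.pullback_apply, hχ x (hWK hx), one_smul,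
      ContinuousAlternatingMap.compContinuousLinearMap_apply]
    rfl
  -- `Φ` is integrable on `W`
  have hΦint : IntegrableOn Φ W μ := by
    have hH := integrableOn_push_smul_frameVector (θ := θ) (ξ := ξ) hf1 hC hWm hGint
    have hmeas : AEStronglyMeasurable Φ (μ.restrict W) := by
      have h1 : AEStronglyMeasurable (fun x => (Multivector.push (m := m) (fderiv ℝ f x)
          ((θ x : ℝ) • frameVector (ξ x)), ψ (f x))) (μ.restrict W) :=
        hH.aestronglyMeasurable.prodMk
          ((ψ.continuous.comp hf.continuous).aestronglyMeasurable)
      have h2 : Continuous fun p : Multivector V' m × Covector V' m => p.1 p.2 :=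
        isBoundedBilinearMap_apply.continuous
      have := h2.comp_aestronglyMeasurable h1
      refine this.congr (Eventually.of_forall fun x => ?_)
      simp only [hΦdef]
      exact (mul_apply_comp_frame_eq_push (θ := θ) (ξ := ξ) (f := f) ψ x).symm
    refine Integrable.mono' (hH.norm.mul_const c) hmeas (Eventually.of_forall fun x => ?_)
    change ‖Φ x‖ ≤ ‖Multivector.push (m := m) (fderiv ℝ f x) ((θ x : ℝ) • frameVector (ξ x))‖ * c
    rw [hΦdef]
    dsimp only
    rw [mul_apply_comp_frame_eq_push (θ := θ) (ξ := ξ) (f := f) ψ x]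
    exact (ContinuousLinearMap.le_opNorm _ _).trans (by gcongr; exact hψc _)
  rw [hpush]
  -- `W` and the union of the pieces differ by a null set
  have hUW : (⋃ j, g j '' E j) ⊆ W := iUnion_subset hgW
  have hWae : (⋃ j, g j '' E j) =ᵐ[μ] W := by
    refine ae_eq_of_subset_of_measure_ge hUW ?_ (MeasurableSet.iUnion hgm).nullMeasurableSet
      hWfin.ne
    calc μ W ≤ μ ((⋃ j, g j '' E j) ∪ (W \ ⋃ j, g j '' E j)) := by rw [union_sdiff_cancel hUW]
      _ ≤ μ (⋃ j, g j '' E j) + μ (W \ ⋃ j, g j '' E j) := measure_union_le _ _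
      _ = μ (⋃ j, g j '' E j) := by rw [hnull, add_zero]
  rw [← setIntegral_congr_set hWae]
  -- `Σⱼ`
  have hsumj : HasSum (fun j => ∫ x in g j '' E j, Φ x ∂μ) (∫ x in ⋃ j, g j '' E j, Φ x ∂μ) :=
    hasSum_integral_iUnion hgm hdisj (hΦint.mono_set hUW)
  -- per piece `j`: `∫_{g j (E j)} Φ = Σₙ R (j, n) ψ`
  have hpiece : ∀ j, HasSum (fun n => R (Nat.pairEquiv (j, n)) ψ) (∫ x in g j '' E j, Φ x ∂μ) := by
    intro j
    set Ψ : 𝔼 → ℝ := fun u => (pieceDensity (g j) θ ξ u : ℝ) *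
      ψ (f (g j u)) (fun i => ((fderiv ℝ f (g j u)).comp (fderiv ℝ (g j) u)) (𝕖 i)) with hΨdef
    have h1 : ∫ x in g j '' E j, Φ x ∂μ = ∫ u in E j, Ψ u :=
      setIntegral_image_piece_eq (hEm j) (hgd j) (hgi j) (hframe j) ψ
    -- `Ψ` is integrable on `E j`
    have hΨint : IntegrableOn Ψ (E j) := by
      have hmeas : AEStronglyMeasurable Ψ (volume.restrict (E j)) := by
        have hA := (hint j).aestronglyMeasurable.prodMk
          ((ψ.continuous.comp (hf.continuous.comp (hgL j).continuous)).aestronglyMeasurable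
            (μ := volume.restrict (E j)))
        have h2 : Continuous fun p : Multivector V' m × Covector V' m => p.1 p.2 :=
          isBoundedBilinearMap_apply.continuous
        refine (h2.comp_aestronglyMeasurable hA).congr (Eventually.of_forall fun u => ?_)
        simp only [comp_apply, hΨdef, _root_.smul_apply, frameVector_apply, smul_eq_mul]
      refine Integrable.mono' ((hint j).norm.mul_const c) hmeas (Eventually.of_forall fun u => ?_)
      change ‖Ψ u‖ ≤ ‖(pieceDensity (g j) θ ξ u : ℝ) •
        frameVector (fun i => ((fderiv ℝ f (g j u)).comp (fderiv ℝ (g j) u)) (𝕖 i))‖ * c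
      have : Ψ u = ((pieceDensity (g j) θ ξ u : ℝ) •
          frameVector (fun i => ((fderiv ℝ f (g j u)).comp (fderiv ℝ (g j) u)) (𝕖 i)))
          (ψ (f (g j u))) := by
        simp only [hΨdef, _root_.smul_apply, frameVector_apply, smul_eq_mul]
      rw [this]
      exact (ContinuousLinearMap.le_opNorm _ _).trans (by gcongr; exact hψc _)
    -- the degenerate part does not contribute
    have h2 : ∫ u in E j, Ψ u = ∫ u in E j ∩ ⋃ n, t j n, Ψ u := by
      refine setIntegral_eq_of_subset_of_forall_sdiff_eq_zero (hEm j) inter_subset_left ?_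
      rintro u ⟨huE, hu⟩
      have hnot : ¬ Injective ((fderiv ℝ f (g j u)).comp (fderiv ℝ (g j) u)) := by
        intro hinj
        refine hu ⟨huE, ?_⟩
        refine hSt j ⟨(hFd j u huE).1, ?_⟩
        rw [(hFd j u huE).2]
        exact hinj
      simp only [hΨdef, apply_comp_eq_zero_of_not_injective hnot 𝕖, mul_zero]
    -- `Σₙ`
    have h3 : HasSum (fun n => ∫ u in E j ∩ t j n, Ψ u) (∫ u in E j ∩ ⋃ n, t j n, Ψ u) := by
      rw [inter_iUnion]
      exact hasSum_integral_iUnion (fun n => (hEm j).inter (htm j n))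
        (fun n n' h => (htdisj j h).mono inter_subset_right inter_subset_right)
        (hΨint.mono_set (iUnion_subset fun n => inter_subset_left))
    have h4 : ∀ n, ∫ u in E j ∩ t j n, Ψ u = R (Nat.pairEquiv (j, n)) ψ := by
      intro n
      have := (hR (Nat.pairEquiv (j, n))).2.1 ψ
      simp only [hRdef, E', jj, nn, Nat.pairEquiv_apply, Function.uncurry_apply_pair,
        Nat.unpair_pair] at this ⊢
      exact this.symm
    rw [h1, h2]
    simpa only [h4] using h3
  -- assemble the double series
  have hRψ' : Summable fun q : ℕ × ℕ => R (Nat.pairEquiv q) ψ :=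
    (Nat.pairEquiv.summable_iff (f := fun k => R k ψ)).2 hRψ
  rw [← Nat.pairEquiv.tsum_eq (fun k => R k ψ), hRψ'.tsum_prod' (fun j => (hpiece j).summable),
    ← hsumj.tsum_eq]
  exact tsum_congr fun j => ((hpiece j).tsum_eq).symm

end Main

end Literature.Geometry.GeometricMeasureTheory
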